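import Mathlib
import HarnessLib
/-!
# Axisymmetric Euler at a MIRROR PLANE: the exact germ (z-Taylor) identities and the frozen swirl shear at the origin

HONEST FRAMING (cell ns-blowup GROUP B «PROFILE SEARCH», zone Z8 «Hou–Luo corner analogue WITHOUT the wall», gate Z8-0;
human rulings D-0035/D-0074/D-0081): **one-variable calculus (product rule at a point) kernel-checked on the z-traces of the
axisymmetric Euler equations in Hou–Li variables; a DESIGN input for a MODEL/(D)-class float experiment; not a statement about
blow-up or regularity of Euler or Navier–Stokes; «violates: none — no object».**

SETTING. Axisymmetric Euler with swirl in Hou–Li variables `u₁ = u^θ/r`, `ω₁ = ω^θ/r`, `ψ₁ = ψ^θ/r` (Hou–Li 2008 / Luo–Hou 2014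
lineage; the tree's `HouLiAxisModel` and `HouLuoProfileEqAt` use the same variables):
  (E1) `∂ₜu₁ + u^r ∂ᵣu₁ + u^z ∂_z u₁ = 2 u₁ ∂_zψ₁`,   (E2) `∂ₜω₁ + u^r ∂ᵣω₁ + u^z ∂_z ω₁ = ∂_z(u₁²) = 2 u₁ ∂_z u₁`,
  (E3) `−(∂ᵣ²ψ₁ + (3/r) ∂ᵣψ₁ + ∂_z²ψ₁) = ω₁`,   `u^r = −r ∂_zψ₁`,   `u^z = 2ψ₁ + r ∂ᵣψ₁`.
Fix `(t, r)` and regard every field and each of its `t`-, `r`-, `z`-partial derivatives as a FUNCTION OF `z : ℝ` (passed as separate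
function symbols, exactly as in `HouLuoOriginLaws`: `u = u₁(t,r,·)`, `du = ∂_z u₁(t,r,·)`, `ut = ∂ₜu₁(t,r,·)`, `ur = ∂ᵣu₁(t,r,·)`,
`vr = u^r(t,r,·)`, `vz = u^z(t,r,·)`, `pz = ∂_zψ₁(t,r,·)`, `dw = ∂_zω₁`, `wt = ∂ₜω₁`, `wr = ∂ᵣω₁`, …); the identification of, e.g., the
`z`-derivative of `ut` at `0` with `∂ₜ(∂_z u₁)(t,r,0)` (Schwarz) is the user's, outside these lemmas. On a MIRROR PLANE `{z = 0}`
(reflection `z ↦ −z`; `ω₁, ψ₁, u^z` odd, `u^r` even; class O: `u₁` odd — Luo–Hou's / Hou's interior data; class E: `u₁` even) one has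
`u^z(t,r,0) = 0` and the class conditions `u₁ = ∂ᵣu₁ = 0` (O) or `∂_z u₁ = ∂_z u^r = 0` (E) at `z = 0`; these enter as hypotheses.

WHAT IS KERNEL-CHECKED (the «germ systems» of the Z8-0 pens — eng-5 `profile/z3twin/Z8-0-DERIVATION-eng5.md` §3–§4, eng-14
`profile/z8twin/Z8-0-PLANE-JET.md` §2 (L1)–(L3), eng-13 `profile/z8/Z8-0-MIRROR-eng13.md` §1; refuter-1 K-READ KILLSHEET-B-Z58 §1.7;
lead RULINGS (bp)/(bq); Z8 SHEET §1.3): writing `a = ∂_z u₁|₀`, `b = ∂_z ω₁|₀`, `c = ∂_zψ₁|₀`, `U = u^r|₀`, `S = ∂_z u^z|₀`,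
`A = u₁|₀`, `G = ∂_z² u₁|₀`,
  * `dz_swirl_eq_at_plane` / `germO_swirl`:       class O  `aₜ + U aᵣ = (2c − S)·a`                         ((G-a) = eng-14 (L1)),
  * `dz_vorticity_eq_at_plane` / `germO_vorticity`: class O `bₜ + U bᵣ = −S·b + 2a²`                     ((G-b) = eng-14 (L2)),
    `germE_vorticity`:                            class E  `bₜ + U bᵣ = −S·b + 2A·G`                         ((H-b)),
  * `swirl_eq_on_plane`:                          class E  `Aₜ + U Aᵣ = 2c·A`                                 ((H-A); Γ transported on the plane),
  * `dz_poisson_at_plane`:                        `−(cᵣᵣ + (3/r) cᵣ + ∂_z³ψ₁|₀) = b`                           ((G-c)/(H-c) with `6d = ∂_z³ψ₁|₀`),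
  * `dzz_swirl_eq_at_plane` / `germE_swirl_curvature`: class E `Gₜ + U Gᵣ = −2S·G + 2c·G − (∂_z²u^r|₀)·Aᵣ + 2A·∂_z³ψ₁|₀` ((H-G)),
  * `axis_normal_strain`, `origin_swirl_shear_frozen`: on the axis `u^z = 2ψ₁` ⇒ `S = 2c`, hence at the ORIGIN in class O
    `∂_z(∂ₜu₁)(t,0,0) = 0` — the swirl shear / radial-vorticity germ `∂_z u₁ = −ω^r/r` at the class-O converging point is FROZEN
    (corollary P2 of the eng-5 pen; the Z8 ENGINE-CHECK row of RULING (bq)(1)(iv); exact at `ν = 0`).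
WHAT IS NOT PROVED HERE: existence/smoothness of any solution, the parity bookkeeping itself, Schwarz's theorem, the maximum-principle
Lemma P (no ring in class O), or anything at `ν > 0`. Only product rules at a point and real algebra; no `def … : Prop` hypotheses,
no definitions. PLACEMENT: cell-own MODEL/design lemma under `Summits/NavierStokesRegularity/OSWSelfSimilar/` next to
`HouLuoOriginLaws` (profile-eng-5 g4). bears on LADDER-NS N5 / zone Z8 (stage-1 design) → N1 linear core.
-/

namespace Summit.NavierStokesRegularity.OSWSelfSimilar
namespace HouLuoMirrorPlaneGerm

/-! ### First `z`-derivative of the swirl equation (E1) at the plane -/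

/-- **(E1) differentiated once in `z` at the plane, general form.** If
`ut z + vr z * ur z + vz z * du z = 2 * u z * pz z` for all `z` (the swirl equation (E1) at fixed `(t, r)` as an identity
in `z`, with `du = ∂_z u₁`), `u^z` vanishes on the plane (`vz 0 = 0`), and the traces are differentiable at `0` with the
named derivative values, then
`∂_z uₜ + (∂_z u^r)·uᵣ + u^r·∂_z uᵣ + S·∂_z u = 2 (∂_z u · ψ_z + u · ψ_zz)` at `z = 0`, where `S = ∂_z u^z(0)`.
[new here — MODEL/design bookkeeping; product rule at a point] -/
theorem dz_swirl_eq_at_plane (u du ut ur vr vz pz : ℝ → ℝ) (ddu0 utz0 urz0 vrz0 S pzz0 : ℝ)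
    (hE1 : ∀ z, ut z + vr z * ur z + vz z * du z = 2 * u z * pz z)
    (hvz0 : vz 0 = 0)
    (hu : HasDerivAt u (du 0) 0) (hdu : HasDerivAt du ddu0 0) (hut : HasDerivAt ut utz0 0)
    (hur : HasDerivAt ur urz0 0) (hvr : HasDerivAt vr vrz0 0) (hvz : HasDerivAt vz S 0)
    (hpz : HasDerivAt pz pzz0 0) :
    utz0 + (vrz0 * ur 0 + vr 0 * urz0) + S * du 0 = 2 * (du 0 * pz 0 + u 0 * pzz0) := by
  have hL : HasDerivAt (fun z => ut z + vr z * ur z + vz z * du z - 2 * u z * pz z)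
      (utz0 + (vrz0 * ur 0 + vr 0 * urz0) + (S * du 0 + vz 0 * ddu0)
        - (2 * du 0 * pz 0 + 2 * u 0 * pzz0)) 0 :=
    ((hut.add (hvr.mul hur)).add (hvz.mul hdu)).sub ((hu.const_mul 2).mul hpz)
  have hfun : (fun z => ut z + vr z * ur z + vz z * du z - 2 * u z * pz z) = fun _ => (0 : ℝ) :=
    funext fun z => sub_eq_zero.mpr (hE1 z)
  have hZ : HasDerivAt (fun z => ut z + vr z * ur z + vz z * du z - 2 * u z * pz z) 0 0 := by
    rw [hfun]
    exact hasDerivAt_const 0 0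
  have huniq := hL.unique hZ
  rw [hvz0] at huniq
  linear_combination huniq

/-- **Class-O germ of the swirl equation, (G-a):** on a mirror plane in the class where `u₁` is ODD in `z`
(`u₁ = ∂ᵣu₁ = 0` at `z = 0`; `u^z = 0` there), writing `a = ∂_z u₁(0)`, `c = ∂_zψ₁(0)`, `U = u^r(0)`, `S = ∂_z u^z(0)`:
`∂_z(∂ₜu₁)(0) + U · ∂_z(∂ᵣu₁)(0) = (2c − S) · a`, i.e. `aₜ + U aᵣ = (2c − S) a = −r cᵣ a` once `S = 2c + r cᵣ` is substituted.
(= eng-14's (L1) `Dg = −(σ + 2U/r) g` with `U = −r c`.) [new here — MODEL/design] -/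
theorem germO_swirl (u du ut ur vr vz pz : ℝ → ℝ) (ddu0 utz0 urz0 vrz0 S pzz0 : ℝ)
    (hE1 : ∀ z, ut z + vr z * ur z + vz z * du z = 2 * u z * pz z)
    (hvz0 : vz 0 = 0) (hu0 : u 0 = 0) (hur0 : ur 0 = 0)
    (hu : HasDerivAt u (du 0) 0) (hdu : HasDerivAt du ddu0 0) (hut : HasDerivAt ut utz0 0)
    (hur : HasDerivAt ur urz0 0) (hvr : HasDerivAt vr vrz0 0) (hvz : HasDerivAt vz S 0)
    (hpz : HasDerivAt pz pzz0 0) :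
    utz0 + vr 0 * urz0 = (2 * pz 0 - S) * du 0 := by
  have h := dz_swirl_eq_at_plane u du ut ur vr vz pz ddu0 utz0 urz0 vrz0 S pzz0 hE1 hvz0 hu hdu hut hur hvr hvz hpz
  rw [hu0, hur0] at h
  linear_combination h

/-- **(E1) on the plane itself, class E, (H-A):** with `u^z(0) = 0`, the swirl equation at `z = 0` reads
`∂ₜu₁(0) + u^r(0) · ∂ᵣu₁(0) = 2 u₁(0) · ∂_zψ₁(0)`, i.e. `Aₜ + U Aᵣ = 2cA` — equivalently `Γ = r² u₁` is purely TRANSPORTED along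
the plane (`(r²A)ₜ + U (r²A)ᵣ = 0` with `U = −r c`). [new here — MODEL/design] -/
theorem swirl_eq_on_plane (u du ut ur vr vz pz : ℝ → ℝ)
    (hE1 : ∀ z, ut z + vr z * ur z + vz z * du z = 2 * u z * pz z) (hvz0 : vz 0 = 0) :
    ut 0 + vr 0 * ur 0 = 2 * u 0 * pz 0 := by
  have h := hE1 0
  rw [hvz0, zero_mul, add_zero] at h
  exact h

/-! ### First `z`-derivative of the vorticity equation (E2) at the plane -/

/-- **(E2) differentiated once in `z` at the plane, general form.** If
`wt z + vr z * wr z + vz z * dw z = 2 * u z * du z` for all `z` (the vorticity equation with source `∂_z(u₁²) = 2u₁∂_z u₁`,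
`dw = ∂_zω₁`), `vz 0 = 0`, and the traces are differentiable at `0`, then
`∂_z ωₜ + (∂_z u^r)·ωᵣ + u^r·∂_z ωᵣ + S·∂_z ω = 2 ((∂_z u)² + u · ∂_z²u)` at `z = 0`. [new here — MODEL/design] -/
theorem dz_vorticity_eq_at_plane (u du dw wt wr vr vz : ℝ → ℝ) (ddu0 ddw0 wtz0 wrz0 vrz0 S : ℝ)
    (hE2 : ∀ z, wt z + vr z * wr z + vz z * dw z = 2 * u z * du z)
    (hvz0 : vz 0 = 0)
    (hu : HasDerivAt u (du 0) 0) (hdu : HasDerivAt du ddu0 0) (hdw : HasDerivAt dw ddw0 0)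
    (hwt : HasDerivAt wt wtz0 0) (hwr : HasDerivAt wr wrz0 0) (hvr : HasDerivAt vr vrz0 0)
    (hvz : HasDerivAt vz S 0) :
    wtz0 + (vrz0 * wr 0 + vr 0 * wrz0) + S * dw 0 = 2 * (du 0 * du 0 + u 0 * ddu0) := by
  have hL : HasDerivAt (fun z => wt z + vr z * wr z + vz z * dw z - 2 * u z * du z)
      (wtz0 + (vrz0 * wr 0 + vr 0 * wrz0) + (S * dw 0 + vz 0 * ddw0)
        - (2 * du 0 * du 0 + 2 * u 0 * ddu0)) 0 :=
    ((hwt.add (hvr.mul hwr)).add (hvz.mul hdw)).sub ((hu.const_mul 2).mul hdu)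
  have hfun : (fun z => wt z + vr z * wr z + vz z * dw z - 2 * u z * du z) = fun _ => (0 : ℝ) :=
    funext fun z => sub_eq_zero.mpr (hE2 z)
  have hZ : HasDerivAt (fun z => wt z + vr z * wr z + vz z * dw z - 2 * u z * du z) 0 0 := by
    rw [hfun]
    exact hasDerivAt_const 0 0
  have huniq := hL.unique hZ
  rw [hvz0] at huniq
  linear_combination huniq

/-- **Class-O germ of the vorticity equation, (G-b):** `ω₁ = 0` on the plane (so `∂ᵣω₁(0) = 0`) and `u₁(0) = 0` (class O)
give, with `b = ∂_zω₁(0)`, `a = ∂_z u₁(0)`: `∂_z(∂ₜω₁)(0) + U · ∂_z(∂ᵣω₁)(0) + S · b = 2 a²`, i.e. `bₜ + U bᵣ = −S b + 2a²`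
— the sign-definite source `2a²` (= eng-14's (L2)). [new here — MODEL/design] -/
theorem germO_vorticity (u du dw wt wr vr vz : ℝ → ℝ) (ddu0 ddw0 wtz0 wrz0 vrz0 S : ℝ)
    (hE2 : ∀ z, wt z + vr z * wr z + vz z * dw z = 2 * u z * du z)
    (hvz0 : vz 0 = 0) (hwr0 : wr 0 = 0) (hu0 : u 0 = 0)
    (hu : HasDerivAt u (du 0) 0) (hdu : HasDerivAt du ddu0 0) (hdw : HasDerivAt dw ddw0 0)
    (hwt : HasDerivAt wt wtz0 0) (hwr : HasDerivAt wr wrz0 0) (hvr : HasDerivAt vr vrz0 0)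
    (hvz : HasDerivAt vz S 0) :
    wtz0 + vr 0 * wrz0 + S * dw 0 = 2 * du 0 ^ 2 := by
  have h := dz_vorticity_eq_at_plane u du dw wt wr vr vz ddu0 ddw0 wtz0 wrz0 vrz0 S hE2 hvz0 hu hdu hdw hwt hwr hvr hvz
  rw [hwr0, hu0] at h
  linear_combination h

/-- **Class-E germ of the vorticity equation, (H-b):** `ω₁ = 0` on the plane (`∂ᵣω₁(0) = 0`) and `∂_z u₁(0) = 0`
(class E, `u₁` even) give, with `A = u₁(0)`, `G = ∂_z²u₁(0)`, `b = ∂_zω₁(0)`: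
`∂_z(∂ₜω₁)(0) + U · ∂_z(∂ᵣω₁)(0) + S · b = 2 A G`, i.e. `bₜ + U bᵣ = −S b + 2AG`. [new here — MODEL/design] -/
theorem germE_vorticity (u du dw wt wr vr vz : ℝ → ℝ) (ddu0 ddw0 wtz0 wrz0 vrz0 S : ℝ)
    (hE2 : ∀ z, wt z + vr z * wr z + vz z * dw z = 2 * u z * du z)
    (hvz0 : vz 0 = 0) (hwr0 : wr 0 = 0) (hdu0 : du 0 = 0)
    (hu : HasDerivAt u (du 0) 0) (hdu : HasDerivAt du ddu0 0) (hdw : HasDerivAt dw ddw0 0)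
    (hwt : HasDerivAt wt wtz0 0) (hwr : HasDerivAt wr wrz0 0) (hvr : HasDerivAt vr vrz0 0)
    (hvz : HasDerivAt vz S 0) :
    wtz0 + vr 0 * wrz0 + S * dw 0 = 2 * u 0 * ddu0 := by
  have h := dz_vorticity_eq_at_plane u du dw wt wr vr vz ddu0 ddw0 wtz0 wrz0 vrz0 S hE2 hvz0 hu hdu hdw hwt hwr hvr hvz
  rw [hwr0, hdu0] at h
  linear_combination h

/-! ### First `z`-derivative of the Poisson equation (E3) at the plane -/

/-- **(E3) differentiated once in `z` at the plane, (G-c)/(H-c):** if `−(prr z + k * pr z + pzz z) = w z` for all `z`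
(`prr = ∂ᵣ²ψ₁`, `pr = ∂ᵣψ₁`, `pzz = ∂_z²ψ₁`, `w = ω₁`, `k = 3/r`) and the traces are differentiable at `0` with
`∂_z prr(0) = crr0` (= `cᵣᵣ`), `∂_z pr(0) = cr0` (= `cᵣ`), `∂_z pzz(0) = pzzz0` (= `∂_z³ψ₁(0) = 6d`), `∂_z w(0) = b0`, then
`−(cᵣᵣ + k cᵣ + ∂_z³ψ₁(0)) = b` — the one place where the class-O germ hierarchy leaks (through `d`). [new here — MODEL/design] -/
theorem dz_poisson_at_plane (prr pr pzz w : ℝ → ℝ) (k crr0 cr0 pzzz0 b0 : ℝ)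
    (hE3 : ∀ z, -(prr z + k * pr z + pzz z) = w z)
    (hprr : HasDerivAt prr crr0 0) (hpr : HasDerivAt pr cr0 0) (hpzz : HasDerivAt pzz pzzz0 0)
    (hw : HasDerivAt w b0 0) :
    -(crr0 + k * cr0 + pzzz0) = b0 := by
  have hL : HasDerivAt (fun z => -(prr z + k * pr z + pzz z) - w z) (-(crr0 + k * cr0 + pzzz0) - b0) 0 :=
    ((hprr.add (hpr.const_mul k)).add hpzz).neg.sub hw
  have hfun : (fun z => -(prr z + k * pr z + pzz z) - w z) = fun _ => (0 : ℝ) :=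
    funext fun z => sub_eq_zero.mpr (hE3 z)
  have hZ : HasDerivAt (fun z => -(prr z + k * pr z + pzz z) - w z) 0 0 := by
    rw [hfun]
    exact hasDerivAt_const 0 0
  have huniq := hL.unique hZ
  linear_combination huniq

/-! ### The axis relation and the frozen swirl shear at the origin (P2) -/

/-- **Normal strain on the axis.** On the symmetry axis `r = 0` one has `u^z(t,0,z) = 2ψ₁(t,0,z)` (from `u^z = 2ψ₁ + r∂ᵣψ₁`);
hence, if `vz z = 2 * p z` for all `z` with `p` differentiable at `0` (`∂_z p(0) = pz0 = c(0)`) and `∂_z u^z(0) = S`, then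
`S = 2 c`. [new here — MODEL/design] -/
theorem axis_normal_strain (vz p : ℝ → ℝ) (S pz0 : ℝ)
    (haxis : ∀ z, vz z = 2 * p z) (hp : HasDerivAt p pz0 0) (hvz : HasDerivAt vz S 0) :
    S = 2 * pz0 := by
  have hfun : vz = fun z => 2 * p z := funext haxis
  have h2 : HasDerivAt (fun z => 2 * p z) (2 * pz0) 0 := hp.const_mul 2
  rw [← hfun] at h2
  exact hvz.unique h2

/-- **P2 — the swirl shear at the origin is FROZEN (class O, inviscid, exact).** At the origin `(r, z) = (0, 0)` of a
class-O axisymmetric Euler flow: `u^r = 0` on the axis (`vr 0 = 0`), `u^z = 0` on the plane, `u₁ = ∂ᵣu₁ = 0` on the plane,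
and the axis relation `S = 2c` (`axis_normal_strain`). Then the `z`-derivative of `∂ₜu₁` at the origin VANISHES:
`∂_z(∂ₜu₁)(t,0,0) = 0` — with Schwarz, `d/dt [∂_z u₁(t,0,0)] = 0`: the radial-vorticity germ `∂_z u₁ = −ω^r/r` at the
class-O converging point never changes (geometrically: `Γ ≈ a₀ r² z` is invariant under axisymmetric incompressible strain).
This is the Z8 ENGINE-CHECK row of RULING (bq)(1)(iv) (exact at `ν = 0`). [new here — MODEL/design] -/
theorem origin_swirl_shear_frozen (u du ut ur vr vz pz : ℝ → ℝ) (ddu0 utz0 urz0 vrz0 S pzz0 : ℝ)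
    (hE1 : ∀ z, ut z + vr z * ur z + vz z * du z = 2 * u z * pz z)
    (hvz0 : vz 0 = 0) (hu0 : u 0 = 0) (hur0 : ur 0 = 0) (hvr0 : vr 0 = 0) (hS : S = 2 * pz 0)
    (hu : HasDerivAt u (du 0) 0) (hdu : HasDerivAt du ddu0 0) (hut : HasDerivAt ut utz0 0)
    (hur : HasDerivAt ur urz0 0) (hvr : HasDerivAt vr vrz0 0) (hvz : HasDerivAt vz S 0)
    (hpz : HasDerivAt pz pzz0 0) :
    utz0 = 0 := by
  have h := germO_swirl u du ut ur vr vz pz ddu0 utz0 urz0 vrz0 S pzz0 hE1 hvz0 hu0 hur0 hu hdu hut hur hvr hvz hpz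
  rw [hvr0, hS] at h
  linear_combination h

/-- **P2 from the axis relation directly:** as `origin_swirl_shear_frozen`, with `S = 2c` DERIVED from `u^z = 2ψ₁` on the axis
(`haxis`) instead of assumed. [new here — MODEL/design] -/
theorem origin_swirl_shear_frozen' (u du ut ur vr vz pz p : ℝ → ℝ) (ddu0 utz0 urz0 vrz0 S pzz0 : ℝ)
    (hE1 : ∀ z, ut z + vr z * ur z + vz z * du z = 2 * u z * pz z)
    (haxis : ∀ z, vz z = 2 * p z) (hp : HasDerivAt p (pz 0) 0)
    (hvz0 : vz 0 = 0) (hu0 : u 0 = 0) (hur0 : ur 0 = 0) (hvr0 : vr 0 = 0)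
    (hu : HasDerivAt u (du 0) 0) (hdu : HasDerivAt du ddu0 0) (hut : HasDerivAt ut utz0 0)
    (hur : HasDerivAt ur urz0 0) (hvr : HasDerivAt vr vrz0 0) (hvz : HasDerivAt vz S 0)
    (hpz : HasDerivAt pz pzz0 0) :
    utz0 = 0 :=
  origin_swirl_shear_frozen u du ut ur vr vz pz ddu0 utz0 urz0 vrz0 S pzz0 hE1 hvz0 hu0 hur0 hvr0
    (axis_normal_strain vz p S (pz 0) haxis hp hvz) hu hdu hut hur hvr hvz hpz

/-! ### Second `z`-derivative of the swirl equation (E1) at the plane (class E needs it) -/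

/-- **(E1) differentiated TWICE in `z` at the plane, general form.** Hypotheses: (E1) as an identity in `z`; every trace has a
derivative FUNCTION on `ℝ` (`ut ↦ dut`, `vr ↦ dvr`, `ur ↦ dur`, `vz ↦ dvz`, `u ↦ du`, `du ↦ ddu`, `pz ↦ dpz`); those are
differentiable at `0` with the named second-derivative values; `u^z(0) = 0`. Conclusion (`S := dvz 0 = ∂_z u^z(0)`):
`∂_z²uₜ + ∂_z²u^r·uᵣ + 2 ∂_z u^r·∂_z uᵣ + u^r·∂_z²uᵣ + ∂_z²u^z·∂_z u + 2 S·∂_z²u = 2 (∂_z²u·ψ_z + 2 ∂_z u·ψ_zz + u·ψ_zzz)`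
at `z = 0`. [new here — MODEL/design; product rule twice] -/
theorem dzz_swirl_eq_at_plane (u du ddu ut dut ur dur vr dvr vz dvz pz dpz : ℝ → ℝ)
    (dddu0 utzz0 urzz0 vrzz0 vzz0 pzzz0 : ℝ)
    (hE1 : ∀ z, ut z + vr z * ur z + vz z * du z = 2 * u z * pz z)
    (hvz0 : vz 0 = 0)
    (hu : ∀ z, HasDerivAt u (du z) z) (hdu : ∀ z, HasDerivAt du (ddu z) z) (hut : ∀ z, HasDerivAt ut (dut z) z)
    (hur : ∀ z, HasDerivAt ur (dur z) z) (hvr : ∀ z, HasDerivAt vr (dvr z) z) (hvz : ∀ z, HasDerivAt vz (dvz z) z)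
    (hpz : ∀ z, HasDerivAt pz (dpz z) z)
    (hddu : HasDerivAt ddu dddu0 0) (hdut : HasDerivAt dut utzz0 0) (hdur : HasDerivAt dur urzz0 0)
    (hdvr : HasDerivAt dvr vrzz0 0) (hdvz : HasDerivAt dvz vzz0 0) (hdpz : HasDerivAt dpz pzzz0 0) :
    utzz0 + vrzz0 * ur 0 + 2 * dvr 0 * dur 0 + vr 0 * urzz0 + vzz0 * du 0 + 2 * dvz 0 * ddu 0
      = 2 * (ddu 0 * pz 0 + 2 * du 0 * dpz 0 + u 0 * pzzz0) := by
  -- Step 1: the first-derivative identity holds at EVERY `z` (uniqueness of derivatives of the zero function).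
  have hD : ∀ z, dut z + (dvr z * ur z + vr z * dur z) + (dvz z * du z + vz z * ddu z)
      - (2 * du z * pz z + 2 * u z * dpz z) = 0 := by
    intro z
    have hL : HasDerivAt (fun y => ut y + vr y * ur y + vz y * du y - 2 * u y * pz y)
        (dut z + (dvr z * ur z + vr z * dur z) + (dvz z * du z + vz z * ddu z)
          - (2 * du z * pz z + 2 * u z * dpz z)) z :=
      (((hut z).add ((hvr z).mul (hur z))).add ((hvz z).mul (hdu z))).sub (((hu z).const_mul 2).mul (hpz z))
    have hfun : (fun y => ut y + vr y * ur y + vz y * du y - 2 * u y * pz y) = fun _ => (0 : ℝ) :=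
      funext fun y => sub_eq_zero.mpr (hE1 y)
    have hZ : HasDerivAt (fun y => ut y + vr y * ur y + vz y * du y - 2 * u y * pz y) 0 z := by
      rw [hfun]
      exact hasDerivAt_const z 0
    exact hL.unique hZ
  -- Step 2: differentiate that identity at `0`.
  have hL2 : HasDerivAt (fun z => dut z + (dvr z * ur z + vr z * dur z) + (dvz z * du z + vz z * ddu z)
      - (2 * du z * pz z + 2 * u z * dpz z))
      (utzz0 + ((vrzz0 * ur 0 + dvr 0 * dur 0) + (dvr 0 * dur 0 + vr 0 * urzz0))
        + ((vzz0 * du 0 + dvz 0 * ddu 0) + (dvz 0 * ddu 0 + vz 0 * dddu0))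
        - ((2 * ddu 0 * pz 0 + 2 * du 0 * dpz 0) + (2 * du 0 * dpz 0 + 2 * u 0 * pzzz0))) 0 :=
    ((hdut.add ((hdvr.mul (hur 0)).add ((hvr 0).mul hdur))).add
      ((hdvz.mul (hdu 0)).add ((hvz 0).mul hddu))).sub
      ((((hdu 0).const_mul 2).mul (hpz 0)).add (((hu 0).const_mul 2).mul hdpz))
  have hfun2 : (fun z => dut z + (dvr z * ur z + vr z * dur z) + (dvz z * du z + vz z * ddu z)
      - (2 * du z * pz z + 2 * u z * dpz z)) = fun _ => (0 : ℝ) := funext hD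
  have hZ2 : HasDerivAt (fun z => dut z + (dvr z * ur z + vr z * dur z) + (dvz z * du z + vz z * ddu z)
      - (2 * du z * pz z + 2 * u z * dpz z)) 0 0 := by
    rw [hfun2]
    exact hasDerivAt_const 0 0
  have huniq := hL2.unique hZ2
  rw [hvz0] at huniq
  linear_combination huniq

/-- **Class-E germ of the swirl equation, (H-G):** in the class where `u₁` is EVEN in `z` (`∂_z u₁(0) = 0`) and `u^r` is even
(`∂_z u^r(0) = 0`), with `A = u₁(0)`, `G = ∂_z²u₁(0)`, `c = ∂_zψ₁(0)`, `U = u^r(0)`, `S = ∂_z u^z(0)`: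
`∂_z²(∂ₜu₁)(0) + U·∂_z²(∂ᵣu₁)(0) = −2S·G + 2c·G − ∂_z²u^r(0)·∂ᵣu₁(0) + 2A·∂_z³ψ₁(0)`,
i.e. `Gₜ + U Gᵣ = −2SG + 2cG + 6 r d Aᵣ + 12 d A` once the kinematic relation `∂_z²u^r = −r ∂_z³ψ₁ = −6 r d` is substituted —
the class-E hierarchy leaks through `d` here AND in the Poisson germ. [new here — MODEL/design] -/
theorem germE_swirl_curvature (u du ddu ut dut ur dur vr dvr vz dvz pz dpz : ℝ → ℝ)
    (dddu0 utzz0 urzz0 vrzz0 vzz0 pzzz0 : ℝ)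
    (hE1 : ∀ z, ut z + vr z * ur z + vz z * du z = 2 * u z * pz z)
    (hvz0 : vz 0 = 0) (hdu0 : du 0 = 0) (hdvr0 : dvr 0 = 0)
    (hu : ∀ z, HasDerivAt u (du z) z) (hdu : ∀ z, HasDerivAt du (ddu z) z) (hut : ∀ z, HasDerivAt ut (dut z) z)
    (hur : ∀ z, HasDerivAt ur (dur z) z) (hvr : ∀ z, HasDerivAt vr (dvr z) z) (hvz : ∀ z, HasDerivAt vz (dvz z) z)
    (hpz : ∀ z, HasDerivAt pz (dpz z) z)
    (hddu : HasDerivAt ddu dddu0 0) (hdut : HasDerivAt dut utzz0 0) (hdur : HasDerivAt dur urzz0 0)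
    (hdvr : HasDerivAt dvr vrzz0 0) (hdvz : HasDerivAt dvz vzz0 0) (hdpz : HasDerivAt dpz pzzz0 0) :
    utzz0 + vr 0 * urzz0
      = -2 * dvz 0 * ddu 0 + 2 * pz 0 * ddu 0 - vrzz0 * ur 0 + 2 * u 0 * pzzz0 := by
  have h := dzz_swirl_eq_at_plane u du ddu ut dut ur dur vr dvr vz dvz pz dpz dddu0 utzz0 urzz0 vrzz0 vzz0 pzzz0
    hE1 hvz0 hu hdu hut hur hvr hvz hpz hddu hdut hdur hdvr hdvz hdpz
  rw [hdu0, hdvr0] at h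
  linear_combination h

/-- **(H-G) with the kinematic substitution.** As `germE_swirl_curvature`, plus `∂_z²u^r(0) = −r·∂_z³ψ₁(0)` (from
`u^r = −r∂_zψ₁`, `hkin`): `Gₜ + U Gᵣ = −2SG + 2cG + r·∂_z³ψ₁(0)·Aᵣ + 2A·∂_z³ψ₁(0)` (and `∂_z³ψ₁(0) = 6d` gives the pen form
`6 r d Aᵣ + 12 d A`). [new here — MODEL/design] -/
theorem germE_swirl_curvature_kin (u du ddu ut dut ur dur vr dvr vz dvz pz dpz : ℝ → ℝ)
    (r dddu0 utzz0 urzz0 vrzz0 vzz0 pzzz0 : ℝ)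
    (hE1 : ∀ z, ut z + vr z * ur z + vz z * du z = 2 * u z * pz z)
    (hvz0 : vz 0 = 0) (hdu0 : du 0 = 0) (hdvr0 : dvr 0 = 0) (hkin : vrzz0 = -r * pzzz0)
    (hu : ∀ z, HasDerivAt u (du z) z) (hdu : ∀ z, HasDerivAt du (ddu z) z) (hut : ∀ z, HasDerivAt ut (dut z) z)
    (hur : ∀ z, HasDerivAt ur (dur z) z) (hvr : ∀ z, HasDerivAt vr (dvr z) z) (hvz : ∀ z, HasDerivAt vz (dvz z) z)
    (hpz : ∀ z, HasDerivAt pz (dpz z) z)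
    (hddu : HasDerivAt ddu dddu0 0) (hdut : HasDerivAt dut utzz0 0) (hdur : HasDerivAt dur urzz0 0)
    (hdvr : HasDerivAt dvr vrzz0 0) (hdvz : HasDerivAt dvz vzz0 0) (hdpz : HasDerivAt dpz pzzz0 0) :
    utzz0 + vr 0 * urzz0
      = -2 * dvz 0 * ddu 0 + 2 * pz 0 * ddu 0 + r * pzzz0 * ur 0 + 2 * u 0 * pzzz0 := by
  have h := germE_swirl_curvature u du ddu ut dut ur dur vr dvr vz dvz pz dpz dddu0 utzz0 urzz0 vrzz0 vzz0 pzzz0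
    hE1 hvz0 hdu0 hdvr0 hu hdu hut hur hvr hvz hpz hddu hdut hdur hdvr hdvz hdpz
  rw [hkin] at h
  linear_combination h

end HouLuoMirrorPlaneGerm
end Summit.NavierStokesRegularity.OSWSelfSimilar
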